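import Literature.NumberTheory.Rogawski1990.FinExplicitTransferFactorDeepValueInert        -- ★ p845204 (F0P3a-p04 (g15)) T5-a∕b, the UNRAMIFIED twin: bookkeeping `finHeckeValue_mul_eq_one_of_mul_eq_one`, `isUnit_of_conjLocal_mul_self`, `sqrt_prod_norm_mul`
import Literature.NumberTheory.Rogawski1990.RankOneUnstableDeltaValueRamifiedTorus           -- ★ p843775 (A-p19 (g23)) R-4c⁺ ED. 1: `exists_finHeckeValue_sub_inv_eq_mul_hilbertSymbol_of_skew`; brings ★ R-4 `sqrt_prod_norm_eq_sqrt_zpow_log_of_ramified`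
import HarnessLib

/-!
# The VALUE of `τ_v(γ_H) · D_{G∕H,v}(γ_H)` for a DEEP `γ_H ∈ H_v` with split `U(Φ₂)`-part at a RAMIFIED non-split place: two Hilbert symbols and `q^{−(N₀+N₁)∕2}`
# ([Rogawski1990] §4.9 p. 55, Lemma 4.9.3 (4.9.2) p. 56, Prop. 8.1.3 p. 116; [LabesseLanglands1979] §2 (2.1)–(2.2))

Topic `NumberTheory/Rogawski1990`; namespace `Literature.NumberTheory.Rogawski1990`.  THEOREMS ONLY (no definition, no instance, no notation, no named fact, no `sorry`).
Cell `pub/hodgecm-mathlib` (D-0151), crux H413 = `stmt-HodgeConjecture-24833`, line «N6nsGerm», last open stub `stub_N6nsS3id` (local `Δ‴_v`-transfer AT THE IDENTITY);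
road «S3-tree» (architect A-p16 (g28) census «S3» v3 0ca147ac §1), brick **T5 «the `Δ‴_v` bookkeeping near `1`»**, row **T5-b′ (RAMIFIED `v`)** of CENSUS-T5
(F0P3a-p04 (g15)) §2∕§4: «twin of ★ `RankOneUnstableDeltaValueRamified{,Tame,Torus,TorusUniform}` ×2».  ROAD-INDEPENDENT: a statement about the ★ explicit factor
`Δ‴_v = τ_v · D_{G∕H,v} · κ_v` (★ `FinExplicitTransferFactor`) alone; the RAMIFIED twin of ★ `FinExplicitTransferFactorDeepValueInert` (p845204).
HONEST LABEL: HC_CM is proved only modulo the printed citations (2 remaining named inputs hLiu418, h413) until rung 0 closes; nothing printed is asserted here.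

THE MATHEMATICS (one non-split place `v` of `L⁺` RAMIFIED in `L`: `w ∣ v`, `e(w|v) = 2`, `f(w|v) = 1`, `E_v = L_w`, `q = #k_v = #k_w`; `μ` with print's guard
`μ|_{𝕀_{L⁺}} = ω_{L∕L⁺}`; a fixed SKEW `η ∈ L_w`, `σ_w η = −η`, `η ≠ 0`).  For `γ_H = (g, u) ∈ H_v` whose `U(Φ₂)`-part has NORM-ONE eigenvalues `d₀, d₁ ∈ E_v` (type-(1)
torus; the caller's frame supplies `χ_g(u) = (u − d₀)(u − d₁)`, `det g⁻¹ · d₀d₁ = 1`), DEEP (`|u_w − (d_i)_w|_w ≤ |2 ι_w ϖ_v^{M₀}|_w`), with CAYLEY PARAMETERS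
`b_i ∈ L⁺_vˣ`, `ι_w b_i = (z_i − 1)∕((z_i + 1)η)`, `z_i = u_w∕(d_i)_w` (★ `exists_units_toPlace_eq_cayley_div` supplies them) and DEPTHS `log|u_w − (d_i)_w|_w = −N_i`:
  `τ_v(γ_H) · D_{G∕H,v}(γ_H) = μ_v(u) · C · (b₀, θ)_v · (b₁, θ)_v · q^{−(N₀+N₁)∕2}`,   `C = μ_v(−1)⁻¹ · μ_w(2η)⁻² ≠ 0`,
where `θ` is the CM generator and `(·,θ)_v` the local Hilbert symbol; here `N₀ ≡ N₁ (mod 2)` AUTOMATICALLY (§1: `log|u_w − (d_i)_w|_w = 2·log|b_i|_v + log|2|_w + log|η|_w`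
and `log|2|_w = 2·log|2|_v`), so `(N₀ + N₁)∕2` is an honest integer and the two half-integral rank-one exponents `q^{−N_i∕2}` of [LabesseLanglands1979] §2 add up to an
INTEGER power — at a tamely ramified place with `η` a skew uniformiser both `N_i = 2r_i + 1` are odd and the value is `q^{−(r₀+r₁+1)}`.
PROOF: as in the unramified twin, `−χ_g(u)∕det g = (−1)(u − d₀)(u − d₁)·det g⁻¹`, `μ_v` multiplicative on units, `μ_v(det g⁻¹) = μ_v(d₀d₁)⁻¹`, the norm multiplicative; so
`τ·D = μ_v(u)·μ_v(−1)⁻¹·μ_v(d₀)μ_v(d₁)·Π_i [μ_v(u − d_i)⁻¹·(Π‖u − d_i‖)^{1∕2}]` and each bracket is ★ R-4c⁺'s `μ_v(d_i)⁻¹·μ_w(2η)⁻¹·(b_i,θ)_v` (the `μ`-part,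
`exists_finHeckeValue_sub_inv_eq_mul_hilbertSymbol_of_skew`) times ★ R-4's `(Π‖u − d_i‖)^{1∕2} = √(q^{log|u − d_i|_w})` (`sqrt_prod_norm_eq_sqrt_zpow_log_of_ramified`);
the two square roots multiply to `q^{−(N₀+N₁)∕2}` by the parity remark.  I.e. the rank-3 factor `Δ_{G∕H} = τ·D` near the identity at a ramified place is the PRODUCT of the
two rank-one ramified values of Lemma 4.9.3 for the pairs `(u, d₀)`, `(u, d₁)` — no new arithmetic beyond ★ R-4∕R-4c⁺ (CENSUS-T5 §4: «+2 files pair by pair» — this is one).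

* §1 valuation bookkeeping of the Cayley parameter: `valued_toPlace_cayley_mul` (`|ι_w b|·|2|_w·|η| = |a_w − c_w|` for norm-one `a, c` with `|a_w − c_w| < |2|_w`),
  `two_mul_log_valued_cayley_eq` (`2·log|b|_v + log|2|_w + log|η|_w = log|a_w − c_w|_w` at a ramified place), `even_depth_add_depth_of_cayley` (two pairs, one `η`:
  `Even (N₀ + N₁)`), `sqrt_zpow_neg_mul_sqrt_zpow_neg_of_even` (`√(q^{−N₀})·√(q^{−N₁}) = (q^{(N₀+N₁)∕2})⁻¹`).
* §2 HEAD **`exists_finTau_mul_finWeylRatio_eq_of_cayley_ramified`** (through ★ p845219 §4 `finTau_mul_finWeylRatio_eq_rankOne_mul_rankOne`, the place-agnostic factorisation).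
* §3 **`exists_finExplicitDelta_eq_of_cayley_ramified`** — the assembled `Δ‴_v = τ·D·κ` on matched pairs, binder order of ★ `exists_finExplicitDelta_eq_of_depths` (END's `hT5ram`).

## References
* [Rogawski1990] J. D. Rogawski, *Automorphic Representations of Unitary Groups in Three Variables*, Ann. of Math. Stud. 123 (1990): §4.9 p. 55 (`τ`, `D_{G∕H}`,
  `μ|_{F^×} = ω_{E∕F}`), Lemma 4.9.3 (4.9.2) p. 56, Prop. 8.1.3 and its proof p. 116 («for `t` sufficiently close to `1`»).
* [LabesseLanglands1979] J.-P. Labesse, R. P. Langlands, *L-indistinguishability for SL(2)*, Canad. J. Math. 31 (1979): §2, (2.1)–(2.2) pp. 8–9 (the ramified torus,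
  `δ_m = 2q^m`, the weight `κ(bϖ^{−m})`).
* [Serre1979] J.-P. Serre, *Local Fields*, GTM 67 (1979): Ch. XIV §3 (the local symbol `(·, θ)_v`).
* [NeukirchANT1999] J. Neukirch, *Algebraic Number Theory* (1999): Ch. II §6 (`‖·‖_w = (#k_w)^{−ord_w}`, `e f = 2`).
-/

set_option autoImplicit false

noncomputable section

open NumberField IsDedekindDomain Filter Topology ValuativeRel
open scoped ValuativeRel

namespace Literature.NumberTheory.Rogawski1990

open Literature.NumberTheory.Automorphic Literature.NumberTheory.Automorphic.UnitaryGroup Literature.NumberTheory.GaloisRepresentations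
open Literature.NumberTheory.QuadraticForms

variable (L : Type) [Field L] [NumberField L] [IsCMField L] (v : HeightOneSpectrum (𝓞 ↥(maximalRealSubfield L)))
  (w : PlacesOver L v) (hw : IsCMField.complexConj L • w.1 = w.1)

/-! ## §1 Valuation bookkeeping of the Cayley parameter at a ramified place -/

section Cayley

include hw in
/-- **`|ι_w b|_w · |2|_w · |η|_w = |a_w − c_w|_w`** for norm-one `a, c ∈ E_v` with `|a_w − c_w|_w < |2|_w` and `ι_w b = (z − 1)∕((z + 1)η)`, `z = a_w∕c_w`
(`|c_w| = 1`, `|z + 1| = |2 + (z − 1)| = |2|_w`).  Any non-split place. [cite: LabesseLanglands1979, §2 (2.2)] [cite: Rogawski1990, §4.9 p. 56] -/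
theorem valued_toPlace_cayley_mul {η : w.1.adicCompletion L} (hη0 : η ≠ 0) {a c : LocalRing L v}
    (hc : conjLocal L (IsCMField.complexConj L) v c * c = 1) (hdeep : Valued.v (a w - c w) < Valued.v (2 : w.1.adicCompletion L))
    {b : v.adicCompletion ↥(maximalRealSubfield L)} (hb : toPlace v w b = (a w / c w - 1) / ((a w / c w + 1) * η)) :
    Valued.v (toPlace v w b) * Valued.v (2 : w.1.adicCompletion L) * Valued.v η = Valued.v (a w - c w) := by
  have hvc : Valued.v (c w) = 1 := valued_apply_eq_one_of_conjLocal_mul_self L v w hw hc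
  have hc0 : c w ≠ 0 := fun h0 => by rw [h0, map_zero] at hvc; exact zero_ne_one hvc
  have hzsub : a w / c w - 1 = (a w - c w) / c w := by field_simp
  have hvz1 : Valued.v (a w / c w - 1) = Valued.v (a w - c w) := by rw [hzsub, map_div₀, hvc, div_one]
  have hvz1lt : Valued.v (a w / c w - 1) < Valued.v (2 : w.1.adicCompletion L) := by rw [hvz1]; exact hdeep
  have hvzp : Valued.v (a w / c w + 1) = Valued.v (2 : w.1.adicCompletion L) := by
    have h : a w / c w + 1 = (a w / c w - 1) + 2 := by ring
    rw [h, Valuation.map_add_eq_of_lt_right _ hvz1lt]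
  have h20 : Valued.v (2 : w.1.adicCompletion L) ≠ 0 := fun h0 => by
    rw [h0] at hdeep
    exact not_lt_zero hdeep
  have hvη0 : Valued.v η ≠ 0 := (Valuation.ne_zero_iff _).2 hη0
  rw [hb, map_div₀, map_mul, hvz1, hvzp, mul_assoc, div_mul_cancel₀ _ (mul_ne_zero h20 hvη0)]

include hw in
/-- **`2·log|b|_v + log|2|_w + log|η|_w = log|a_w − c_w|_w` AT A RAMIFIED PLACE** (`|ι_w b|_w = |b|_v²`, ★ `valued_toPlace`, `e(w|v) = 2`), for norm-one `a, c` with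
`|a_w − c_w|_w < |2|_w` and `b ∈ L⁺_vˣ` the Cayley parameter w.r.t. the skew `η ≠ 0`.  Since `log|2|_w = 2·log|2|_v` too, the PARITY of the depth `−log|a_w − c_w|_w` is
that of `log|η|_w` — independent of the pair `(a, c)`. [cite: LabesseLanglands1979, §2 (2.2) (`δ_m = 2q^m`)] [cite: NeukirchANT1999, Ch. II §6] -/
theorem two_mul_log_valued_cayley_eq (he : v.asIdeal.ramificationIdx' w.1.asIdeal ≠ 1) {η : w.1.adicCompletion L} (hη0 : η ≠ 0) {a c : LocalRing L v}
    (hc : conjLocal L (IsCMField.complexConj L) v c * c = 1) (hdeep : Valued.v (a w - c w) < Valued.v (2 : w.1.adicCompletion L))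
    (b : (v.adicCompletion ↥(maximalRealSubfield L))ˣ)
    (hb : toPlace v w (b : v.adicCompletion ↥(maximalRealSubfield L)) = (a w / c w - 1) / ((a w / c w + 1) * η)) :
    2 * WithZero.log (Valued.v (b : v.adicCompletion ↥(maximalRealSubfield L))) + WithZero.log (Valued.v (2 : w.1.adicCompletion L)) +
        WithZero.log (Valued.v η) = WithZero.log (Valued.v (a w - c w)) := by
  have hc1 : IsCMField.complexConj L ≠ 1 := IsCMField.complexConj_ne_one L
  haveI := PlacesOver.liesOver (E := L) w
  have he2 : v.asIdeal.ramificationIdx' w.1.asIdeal = 2 :=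
    Liu2021.LemD1IndexedNonVacuityRamifiedPlace.ramificationIdx'_eq_two_of_ne_one L v (IsCMField.complexConj L) hc1 w hw he
  have h := valued_toPlace_cayley_mul L v w hw hη0 hc hdeep hb
  have hvb0 : Valued.v (b : v.adicCompletion ↥(maximalRealSubfield L)) ≠ 0 := (Valuation.ne_zero_iff _).2 b.ne_zero
  have h20 : Valued.v (2 : w.1.adicCompletion L) ≠ 0 := fun h0 => by
    rw [h0] at hdeep
    exact not_lt_zero hdeep
  have hvη0 : Valued.v η ≠ 0 := (Valuation.ne_zero_iff _).2 hη0
  have hac0 : Valued.v (a w - c w) ≠ 0 := by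
    rw [← h]
    exact mul_ne_zero (mul_ne_zero (by rw [valued_toPlace, he2]; exact pow_ne_zero 2 hvb0) h20) hvη0
  rw [valued_toPlace, he2] at h
  have h' := congrArg WithZero.log h
  rw [WithZero.log_mul (mul_ne_zero (pow_ne_zero 2 hvb0) h20) hvη0, WithZero.log_mul (pow_ne_zero 2 hvb0) h20,
    WithZero.log_pow] at h'
  simpa [nsmul_eq_mul] using h'

include hw in
/-- **PARITY: `N₀ + N₁` IS EVEN** for two deep norm-one pairs `(a, c₀)`, `(a, c₁)` with Cayley parameters w.r.t. the SAME skew `η` at a ramified place, `log|a_w − (c_i)_w|_w = −N_i`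
(both `N_i ≡ log|η|_w (mod 2)` by `two_mul_log_valued_cayley_eq` and `log|2|_w = 2·log|2|_v`). [cite: LabesseLanglands1979, §2 (2.2)] [cite: NeukirchANT1999, Ch. II §6] -/
theorem even_depth_add_depth_of_cayley (he : v.asIdeal.ramificationIdx' w.1.asIdeal ≠ 1) {η : w.1.adicCompletion L} (hη0 : η ≠ 0) {a c₀ c₁ : LocalRing L v}
    (hc₀ : conjLocal L (IsCMField.complexConj L) v c₀ * c₀ = 1) (hc₁ : conjLocal L (IsCMField.complexConj L) v c₁ * c₁ = 1)
    (hdeep₀ : Valued.v (a w - c₀ w) < Valued.v (2 : w.1.adicCompletion L)) (hdeep₁ : Valued.v (a w - c₁ w) < Valued.v (2 : w.1.adicCompletion L))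
    (b₀ b₁ : (v.adicCompletion ↥(maximalRealSubfield L))ˣ)
    (hb₀ : toPlace v w (b₀ : v.adicCompletion ↥(maximalRealSubfield L)) = (a w / c₀ w - 1) / ((a w / c₀ w + 1) * η))
    (hb₁ : toPlace v w (b₁ : v.adicCompletion ↥(maximalRealSubfield L)) = (a w / c₁ w - 1) / ((a w / c₁ w + 1) * η))
    {N₀ N₁ : ℕ} (hN₀ : WithZero.log (Valued.v (a w - c₀ w)) = -(N₀ : ℤ)) (hN₁ : WithZero.log (Valued.v (a w - c₁ w)) = -(N₁ : ℤ)) :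
    Even (N₀ + N₁) := by
  have h₀ := two_mul_log_valued_cayley_eq L v w hw he hη0 hc₀ hdeep₀ b₀ hb₀
  have h₁ := two_mul_log_valued_cayley_eq L v w hw he hη0 hc₁ hdeep₁ b₁ hb₁
  rw [hN₀] at h₀
  rw [hN₁] at h₁
  -- `N₀ + N₁ = −2(log b₀ + log b₁) − 2 log|2|_w − 2 log|η|`
  have hsum : ((N₀ + N₁ : ℕ) : ℤ) = 2 * (-(WithZero.log (Valued.v (b₀ : v.adicCompletion ↥(maximalRealSubfield L))) +
      WithZero.log (Valued.v (b₁ : v.adicCompletion ↥(maximalRealSubfield L))) + WithZero.log (Valued.v (2 : w.1.adicCompletion L)) + WithZero.log (Valued.v η))) := by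
    push_cast
    linarith
  have : Even ((N₀ + N₁ : ℕ) : ℤ) := ⟨-(WithZero.log (Valued.v (b₀ : v.adicCompletion ↥(maximalRealSubfield L))) +
      WithZero.log (Valued.v (b₁ : v.adicCompletion ↥(maximalRealSubfield L))) + WithZero.log (Valued.v (2 : w.1.adicCompletion L)) + WithZero.log (Valued.v η)),
    by rw [hsum]; ring⟩
  exact (Int.even_coe_nat _).1 this

/-- **`√(q^{−N₀}) · √(q^{−N₁}) = (q^{(N₀+N₁)∕2})⁻¹`** for `q ≥ 0` (`q ≠ 0`) and `N₀ + N₁` even. [cite: NeukirchANT1999, Ch. II §6] -/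
theorem sqrt_zpow_neg_mul_sqrt_zpow_neg_of_even {q : ℝ} (hq : 0 < q) {N₀ N₁ : ℕ} (hN : Even (N₀ + N₁)) :
    Real.sqrt (q ^ (-(N₀ : ℤ))) * Real.sqrt (q ^ (-(N₁ : ℤ))) = (q ^ ((N₀ + N₁) / 2))⁻¹ := by
  obtain ⟨k, hk⟩ := hN
  have hk2 : (N₀ + N₁) / 2 = k := by omega
  rw [hk2, ← Real.sqrt_mul (zpow_nonneg hq.le _), ← zpow_add₀ hq.ne', show (-(N₀ : ℤ)) + -(N₁ : ℤ) = -(((k + k : ℕ)) : ℤ) by push_cast; omega,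
    zpow_neg, Real.sqrt_inv, zpow_natCast, ← two_mul, pow_mul', Real.sqrt_sq (by positivity)]

end Cayley

/-! ## §2 HEAD — `τ_v · D_{G∕H,v}` on the deep type-(1) locus at a ramified place -/

section Head

variable (he : v.asIdeal.ramificationIdx' w.1.asIdeal ≠ 1) (μ : HeckeCharacter L)
  (hμω : ∀ x : ideleGroup ↥(maximalRealSubfield L), μ (AdeleRing.ideleBaseChange ↥(maximalRealSubfield L) L x) = quadraticHeckeCharCM L x)

include hw he hμω in
/-- **HEAD (T5-b′).**  At a non-split place `v` RAMIFIED in the CM field `L` (`w ∣ v`, `e(w|v) ≠ 1`; NO tameness hypothesis), for `μ` with print's guard `μ|_{𝕀_{L⁺}} = ω_{L∕L⁺}`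
and every skew `η ≠ 0` of `L_w`: there are a level `M₀` and a constant `C ≠ 0` (`C = μ_v(−1)⁻¹·μ_w(2η)⁻²`) such that for every `γ_H = (g, u) ∈ H_v`, norm-one `d₀, d₁ ∈ E_v`
with `χ_g(u) = (u − d₀)(u − d₁)`, `det g⁻¹·(d₀d₁) = 1` (the eigenvalues of `g`, from the caller's frame), DEEP (`|u_w − (d_i)_w|_w ≤ |2 ι_w ϖ_v^{M₀}|_w`), Cayley parameters
`b_i ∈ L⁺_vˣ` (`ι_w b_i = (u_w∕(d_i)_w − 1)∕((u_w∕(d_i)_w + 1)η)`) and depths `log|u_w − (d_i)_w|_w = −N_i`: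
`τ_v(γ_H) · D_{G∕H,v}(γ_H) = μ_v(u) · C · (b₀, θ)_v · (b₁, θ)_v · (q^{(N₀+N₁)∕2})⁻¹` (`q = #k_v`; `N₀ + N₁` is even, `even_depth_add_depth_of_cayley`) — the rank-3 factor
is the product of the two rank-one ramified values of ★ R-4c⁺.  RAMIFIED twin of ★ `exists_finTau_mul_finWeylRatio_eq_of_depths`.
[cite: Rogawski1990, §4.9 p. 55; Lemma 4.9.3 (4.9.2) p. 56; Prop. 8.1.3 p. 116] [cite: LabesseLanglands1979, §2 (2.1)–(2.2)] [cite: Serre1979, Ch. XIV §3] -/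
theorem exists_finTau_mul_finWeylRatio_eq_of_cayley_ramified {η : w.1.adicCompletion L}
    (hση : galAdicCompletionMap (L := L) (IsCMField.complexConj L) hw η = -η) (hη0 : η ≠ 0) :
    ∃ (M₀ : ℕ) (C : ℂ), C ≠ 0 ∧
      ∀ (γH : (cmDatum L 2 (Matrix.of fun i j : Fin 2 => if i.val + j.val + 1 = 2 then (1 : L) else 0)).Local v ×
          (cmDatum L 1 (Matrix.of fun i j : Fin 1 => if i.val + j.val + 1 = 1 then (1 : L) else 0)).Local v)
        (d₀ d₁ : LocalRing L v) (b₀ b₁ : (v.adicCompletion ↥(maximalRealSubfield L))ˣ) (N₀ N₁ : ℕ),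
        conjLocal L (IsCMField.complexConj L) v d₀ * d₀ = 1 → conjLocal L (IsCMField.complexConj L) v d₁ * d₁ = 1 →
        conjLocal L (IsCMField.complexConj L) v (finGammaTwo L v γH) * finGammaTwo L v γH = 1 →
        (finCharpolyTwo L v γH).eval (finGammaTwo L v γH) = (finGammaTwo L v γH - d₀) * (finGammaTwo L v γH - d₁) →
        ((γH.1.val⁻¹).val : Matrix (Fin 2) (Fin 2) (LocalRing L v)).det * (d₀ * d₁) = 1 →
        Valued.v (finGammaTwo L v γH w - d₀ w) ≤
          Valued.v (2 * (toPlace v w (HeckeCharacter.uniformizer ↥(maximalRealSubfield L) v : v.adicCompletion ↥(maximalRealSubfield L))) ^ M₀) →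
        Valued.v (finGammaTwo L v γH w - d₁ w) ≤
          Valued.v (2 * (toPlace v w (HeckeCharacter.uniformizer ↥(maximalRealSubfield L) v : v.adicCompletion ↥(maximalRealSubfield L))) ^ M₀) →
        toPlace v w (b₀ : v.adicCompletion ↥(maximalRealSubfield L)) =
          (finGammaTwo L v γH w / d₀ w - 1) / ((finGammaTwo L v γH w / d₀ w + 1) * η) →
        toPlace v w (b₁ : v.adicCompletion ↥(maximalRealSubfield L)) =
          (finGammaTwo L v γH w / d₁ w - 1) / ((finGammaTwo L v γH w / d₁ w + 1) * η) →
        WithZero.log (Valued.v (finGammaTwo L v γH w - d₀ w)) = -(N₀ : ℤ) →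
        WithZero.log (Valued.v (finGammaTwo L v γH w - d₁ w)) = -(N₁ : ℤ) →
        finTau L v γH μ * (finWeylRatio L v γH : ℂ) =
          finHeckeValue L v μ (finGammaTwo L v γH) * C *
            (((hilbertSymbol (v.adicCompletion ↥(maximalRealSubfield L)) (b₀ : v.adicCompletion ↥(maximalRealSubfield L))
                (algebraMap ↥(maximalRealSubfield L) _ ((cmQuadraticGenerator L : 𝓞 ↥(maximalRealSubfield L)) : ↥(maximalRealSubfield L))) : ℤ) : ℂ) *
              ((hilbertSymbol (v.adicCompletion ↥(maximalRealSubfield L)) (b₁ : v.adicCompletion ↥(maximalRealSubfield L))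
                (algebraMap ↥(maximalRealSubfield L) _ ((cmQuadraticGenerator L : 𝓞 ↥(maximalRealSubfield L)) : ↥(maximalRealSubfield L))) : ℤ) : ℂ) *
              (((Nat.card (𝓞 ↥(maximalRealSubfield L) ⧸ v.asIdeal) : ℂ)) ^ ((N₀ + N₁) / 2))⁻¹) := by
  classical
  have hc1 : IsCMField.complexConj L ≠ 1 := IsCMField.complexConj_ne_one L
  haveI hv : Subsingleton (PlacesOver L v) := PlacesOver.subsingleton_of_smul_eq (IsCMField.complexConj L) hc1 w hw
  obtain ⟨M₀, C₁, hM₁, hC₁, hcore⟩ := exists_finHeckeValue_sub_inv_eq_mul_hilbertSymbol_of_skew L v w hw μ hμω hση hη0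
  have hm1 : IsUnit (-1 : LocalRing L v) := isUnit_one.neg
  have hμm1 : finHeckeValue L v μ (-1) ≠ 0 := finHeckeValue_ne_zero_of_isUnit L v μ hm1
  refine ⟨M₀, (finHeckeValue L v μ (-1))⁻¹ * (C₁⁻¹ * C₁⁻¹), mul_ne_zero (inv_ne_zero hμm1) (mul_ne_zero (inv_ne_zero hC₁) (inv_ne_zero hC₁)),
    fun γH d₀ d₁ b₀ b₁ N₀ N₁ hd₀ hd₁ _hu hχ hdet hdeep₀ hdeep₁ hb₀ hb₁ hN₀ hN₁ => ?_⟩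
  set u := finGammaTwo L v γH with hudef
  set q : ℂ := (Nat.card (𝓞 ↥(maximalRealSubfield L) ⧸ v.asIdeal) : ℂ) with hqdef
  set ε₀ : ℂ := ((hilbertSymbol (v.adicCompletion ↥(maximalRealSubfield L)) (b₀ : v.adicCompletion ↥(maximalRealSubfield L))
    (algebraMap ↥(maximalRealSubfield L) _ ((cmQuadraticGenerator L : 𝓞 ↥(maximalRealSubfield L)) : ↥(maximalRealSubfield L))) : ℤ) : ℂ) with hε₀def
  set ε₁ : ℂ := ((hilbertSymbol (v.adicCompletion ↥(maximalRealSubfield L)) (b₁ : v.adicCompletion ↥(maximalRealSubfield L))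
    (algebraMap ↥(maximalRealSubfield L) _ ((cmQuadraticGenerator L : 𝓞 ↥(maximalRealSubfield L)) : ↥(maximalRealSubfield L))) : ℤ) : ℂ) with hε₁def
  -- `|2 ι_w ϖ_v^{M₀}|_w < |2|_w` (`M₀ ≥ 1`), so both pairs are deep in §1's sense and `N₀ + N₁` is even
  have h20 : (2 : w.1.adicCompletion L) ≠ 0 := by
    rw [show (2 : w.1.adicCompletion L) = algebraMap L (w.1.adicCompletion L) 2 from (map_ofNat _ 2).symm]
    exact (map_ne_zero_iff _ (algebraMap L (w.1.adicCompletion L)).injective).2 two_ne_zero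
  have hv20 : Valued.v (2 : w.1.adicCompletion L) ≠ 0 := (Valuation.ne_zero_iff _).2 h20
  have hϖlt : Valued.v ((toPlace v w (HeckeCharacter.uniformizer ↥(maximalRealSubfield L) v : v.adicCompletion ↥(maximalRealSubfield L))) ^ M₀) < 1 := by
    rw [map_pow, (valued_toPlace_uniformizer_of_ramified L (IsCMField.complexConj L) hc1 w hw he).1, ← WithZero.exp_nsmul, nsmul_eq_mul,
      ← WithZero.exp_zero, WithZero.exp_lt_exp]
    have : (1 : ℤ) ≤ M₀ := by exact_mod_cast hM₁
    linarith
  have h2lt : Valued.v (2 * (toPlace v w (HeckeCharacter.uniformizer ↥(maximalRealSubfield L) v : v.adicCompletion ↥(maximalRealSubfield L))) ^ M₀) <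
      Valued.v (2 : w.1.adicCompletion L) := by
    rw [map_mul]
    exact mul_lt_of_lt_one_right (zero_lt_iff.2 hv20) hϖlt
  have hdeep₀' : Valued.v (u w - d₀ w) < Valued.v (2 : w.1.adicCompletion L) := lt_of_le_of_lt hdeep₀ h2lt
  have hdeep₁' : Valued.v (u w - d₁ w) < Valued.v (2 : w.1.adicCompletion L) := lt_of_le_of_lt hdeep₁ h2lt
  have hev : Even (N₀ + N₁) := even_depth_add_depth_of_cayley L v w hw he hη0 hd₀ hd₁ hdeep₀' hdeep₁' b₀ b₁ hb₀ hb₁ hN₀ hN₁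
  -- `u − d_i ≠ 0` at `w` (else the Cayley parameter `b_i`, a unit, would map to `0`), hence units
  have hne : ∀ {d : LocalRing L v} {b : (v.adicCompletion ↥(maximalRealSubfield L))ˣ}, conjLocal L (IsCMField.complexConj L) v d * d = 1 →
      toPlace v w (b : v.adicCompletion ↥(maximalRealSubfield L)) = (u w / d w - 1) / ((u w / d w + 1) * η) → (u - d) w ≠ 0 := by
    intro d b hd hb h0
    have hvd : Valued.v (d w) = 1 := valued_apply_eq_one_of_conjLocal_mul_self L v w hw hd
    have hd0 : d w ≠ 0 := fun h00 => by rw [h00, map_zero] at hvd; exact zero_ne_one hvd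
    have hb0 : toPlace v w (b : v.adicCompletion ↥(maximalRealSubfield L)) ≠ 0 := by
      rw [Ne, map_eq_zero_iff _ (toPlace v w).injective]; exact b.ne_zero
    apply hb0
    have huw : u w = d w := sub_eq_zero.1 (by rwa [Pi.sub_apply] at h0)
    rw [hb, huw, div_self hd0, sub_self, zero_div]
  have hx₀ : (u - d₀) w ≠ 0 := hne hd₀ hb₀
  have hx₁ : (u - d₁) w ≠ 0 := hne hd₁ hb₁
  have hud₀ : IsUnit (u - d₀) := isUnit_localRing_of_ne_zero_of_subsingleton L v hv fun h0 => hx₀ (by rw [h0, Pi.zero_apply])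
  have hud₁ : IsUnit (u - d₁) := isUnit_localRing_of_ne_zero_of_subsingleton L v hv fun h0 => hx₁ (by rw [h0, Pi.zero_apply])
  have hμd₀ : finHeckeValue L v μ d₀ ≠ 0 := finHeckeValue_ne_zero_of_isUnit L v μ (isUnit_of_conjLocal_mul_self L v hd₀)
  have hμd₁ : finHeckeValue L v μ d₁ ≠ 0 := finHeckeValue_ne_zero_of_isUnit L v μ (isUnit_of_conjLocal_mul_self L v hd₁)
  -- the two rank-one `μ`-values (★ R-4c⁺)
  have h₀ := hcore u d₀ b₀ hd₀ hdeep₀ hb₀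
  have h₁ := hcore u d₁ b₁ hd₁ hdeep₁ hb₁
  -- the two rank-one `D`-values (★ R-4) and their product
  have hD₀ := sqrt_prod_norm_eq_sqrt_zpow_log_of_ramified L v w hw he (x := u - d₀) hx₀
  have hD₁ := sqrt_prod_norm_eq_sqrt_zpow_log_of_ramified L v w hw he (x := u - d₁) hx₁
  rw [Pi.sub_apply, hN₀] at hD₀
  rw [Pi.sub_apply, hN₁] at hD₁
  have hq0 : 0 < Nat.card (𝓞 ↥(maximalRealSubfield L) ⧸ v.asIdeal) := Nat.card_pos
  have hqpos : (0 : ℝ) < (Nat.card (𝓞 ↥(maximalRealSubfield L) ⧸ v.asIdeal) : ℝ) := by exact_mod_cast hq0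
  have hDD : ((Real.sqrt (∏ w' : PlacesOver L v, ‖(u - d₀) w'‖) : ℝ) : ℂ) * ((Real.sqrt (∏ w' : PlacesOver L v, ‖(u - d₁) w'‖) : ℝ) : ℂ) =
      (q ^ ((N₀ + N₁) / 2))⁻¹ := by
    rw [hD₀, hD₁, ← Complex.ofReal_mul, sqrt_zpow_neg_mul_sqrt_zpow_neg_of_even hqpos hev, hqdef]
    push_cast
    rfl
  -- assemble through the ★ place-agnostic factorisation (p845219 §4)
  rw [finTau_mul_finWeylRatio_eq_rankOne_mul_rankOne L v μ γH d₀ d₁ hd₀ hd₁ hχ hdet hud₀ hud₁, ← hudef, h₀, h₁]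
  calc finHeckeValue L v μ u * (finHeckeValue L v μ (-1))⁻¹ *
        (finHeckeValue L v μ d₀ * ((finHeckeValue L v μ d₀)⁻¹ * C₁⁻¹ * ε₀ * ((Real.sqrt (∏ w' : PlacesOver L v, ‖(u - d₀) w'‖) : ℝ) : ℂ)) *
          (finHeckeValue L v μ d₁ * ((finHeckeValue L v μ d₁)⁻¹ * C₁⁻¹ * ε₁ * ((Real.sqrt (∏ w' : PlacesOver L v, ‖(u - d₁) w'‖) : ℝ) : ℂ))))
      = finHeckeValue L v μ u * (finHeckeValue L v μ (-1))⁻¹ * (finHeckeValue L v μ d₀ * (finHeckeValue L v μ d₀)⁻¹) *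
          (finHeckeValue L v μ d₁ * (finHeckeValue L v μ d₁)⁻¹) * (C₁⁻¹ * C₁⁻¹) * (ε₀ * ε₁) *
          (((Real.sqrt (∏ w' : PlacesOver L v, ‖(u - d₀) w'‖) : ℝ) : ℂ) * ((Real.sqrt (∏ w' : PlacesOver L v, ‖(u - d₁) w'‖) : ℝ) : ℂ)) := by ring
    _ = finHeckeValue L v μ u * ((finHeckeValue L v μ (-1))⁻¹ * (C₁⁻¹ * C₁⁻¹)) * (ε₀ * ε₁ * (q ^ ((N₀ + N₁) / 2))⁻¹) := by
        rw [hDD, mul_inv_cancel₀ hμd₀, mul_inv_cancel₀ hμd₁]; ring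

end Head

/-! ## §3 The ASSEMBLED factor `Δ‴_v` on matched pairs at a ramified place (road «S3-tree» T5-d′, contract binder `hT5ram`) -/

section Assembly

variable (he : v.asIdeal.ramificationIdx' w.1.asIdeal ≠ 1) (μ : HeckeCharacter L)
  (hμω : ∀ x : ideleGroup ↥(maximalRealSubfield L), μ (AdeleRing.ideleBaseChange ↥(maximalRealSubfield L) L x) = quadraticHeckeCharCM L x)

include hw he hμω in
/-- **T5-d′ — THE ASSEMBLED FACTOR on matched pairs at a RAMIFIED non-split place** (binder order = ★ `exists_finExplicitDelta_eq_of_depths`, the unramified `hT5`, with the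
depth data `(b₀ b₁ N₀ N₁)` in place of `(n₀ n₁)`; only the VALUE CLAUSE differs).  Guard `μ|_{𝕀_{L⁺}} = ω`, skew `η ≠ 0`: there are `M₀` and `C ≠ 0` such that for every deep
type-(1) `γ_H` (frame identities, depths `|u_w − (d_i)_w| ≤ |2 ι_w ϖ_v^{M₀}|`, Cayley parameters `b_i`, `log|u_w − (d_i)_w|_w = −N_i`) and every `γ′ ∈ G′_v` MATCHED with
`γ_H` (★ `IsLocalNormPair`): `Δ‴_v(γ_H, γ′) = μ_v(u) · C · ((b₀,θ)_v (b₁,θ)_v q^{−(N₀+N₁)∕2}) · κ_v(γ_H, γ′)` (★ `finExplicitDelta_of_isLocalNormPair`: `Δ‴ = τ·D·κ`).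
[cite: Rogawski1990, §4.9 p. 55; Lemma 4.9.3 (4.9.2) p. 56; Prop. 8.1.3 p. 116] [cite: LabesseLanglands1979, §2 (2.1)–(2.2)] -/
theorem exists_finExplicitDelta_eq_of_cayley_ramified (H' : Matrix (Fin 3) (Fin 3) L) {η : w.1.adicCompletion L}
    (hση : galAdicCompletionMap (L := L) (IsCMField.complexConj L) hw η = -η) (hη0 : η ≠ 0) :
    ∃ (M₀ : ℕ) (C : ℂ), C ≠ 0 ∧
      ∀ (γH : (cmDatum L 2 (Matrix.of fun i j : Fin 2 => if i.val + j.val + 1 = 2 then (1 : L) else 0)).Local v ×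
          (cmDatum L 1 (Matrix.of fun i j : Fin 1 => if i.val + j.val + 1 = 1 then (1 : L) else 0)).Local v)
        (d₀ d₁ : LocalRing L v) (b₀ b₁ : (v.adicCompletion ↥(maximalRealSubfield L))ˣ) (N₀ N₁ : ℕ) (γ' : (cmDatum L 3 H').Local v),
        conjLocal L (IsCMField.complexConj L) v d₀ * d₀ = 1 → conjLocal L (IsCMField.complexConj L) v d₁ * d₁ = 1 →
        conjLocal L (IsCMField.complexConj L) v (finGammaTwo L v γH) * finGammaTwo L v γH = 1 →
        (finCharpolyTwo L v γH).eval (finGammaTwo L v γH) = (finGammaTwo L v γH - d₀) * (finGammaTwo L v γH - d₁) →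
        ((γH.1.val⁻¹).val : Matrix (Fin 2) (Fin 2) (LocalRing L v)).det * (d₀ * d₁) = 1 →
        Valued.v (finGammaTwo L v γH w - d₀ w) ≤
          Valued.v (2 * (toPlace v w (HeckeCharacter.uniformizer ↥(maximalRealSubfield L) v : v.adicCompletion ↥(maximalRealSubfield L))) ^ M₀) →
        Valued.v (finGammaTwo L v γH w - d₁ w) ≤
          Valued.v (2 * (toPlace v w (HeckeCharacter.uniformizer ↥(maximalRealSubfield L) v : v.adicCompletion ↥(maximalRealSubfield L))) ^ M₀) →
        toPlace v w (b₀ : v.adicCompletion ↥(maximalRealSubfield L)) =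
          (finGammaTwo L v γH w / d₀ w - 1) / ((finGammaTwo L v γH w / d₀ w + 1) * η) →
        toPlace v w (b₁ : v.adicCompletion ↥(maximalRealSubfield L)) =
          (finGammaTwo L v γH w / d₁ w - 1) / ((finGammaTwo L v γH w / d₁ w + 1) * η) →
        WithZero.log (Valued.v (finGammaTwo L v γH w - d₀ w)) = -(N₀ : ℤ) →
        WithZero.log (Valued.v (finGammaTwo L v γH w - d₁ w)) = -(N₁ : ℤ) →
        IsLocalNormPair L H' v γH γ' →
        finExplicitDelta L v H' γH μ γ' =
          finHeckeValue L v μ (finGammaTwo L v γH) * C *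
            (((hilbertSymbol (v.adicCompletion ↥(maximalRealSubfield L)) (b₀ : v.adicCompletion ↥(maximalRealSubfield L))
                (algebraMap ↥(maximalRealSubfield L) _ ((cmQuadraticGenerator L : 𝓞 ↥(maximalRealSubfield L)) : ↥(maximalRealSubfield L))) : ℤ) : ℂ) *
              ((hilbertSymbol (v.adicCompletion ↥(maximalRealSubfield L)) (b₁ : v.adicCompletion ↥(maximalRealSubfield L))
                (algebraMap ↥(maximalRealSubfield L) _ ((cmQuadraticGenerator L : 𝓞 ↥(maximalRealSubfield L)) : ↥(maximalRealSubfield L))) : ℤ) : ℂ) *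
              (((Nat.card (𝓞 ↥(maximalRealSubfield L) ⧸ v.asIdeal) : ℂ)) ^ ((N₀ + N₁) / 2))⁻¹) *
            ((finKappaAt L v H' γH γ' : ℤ) : ℂ) := by
  obtain ⟨M₀, C, hC, h⟩ := exists_finTau_mul_finWeylRatio_eq_of_cayley_ramified L v w hw he μ hμω hση hη0
  refine ⟨M₀, C, hC, fun γH d₀ d₁ b₀ b₁ N₀ N₁ γ' hd₀ hd₁ hu hχ hdet hdeep₀ hdeep₁ hb₀ hb₁ hN₀ hN₁ hpair => ?_⟩
  rw [finExplicitDelta_of_isLocalNormPair L v H' γH μ hpair, h γH d₀ d₁ b₀ b₁ N₀ N₁ hd₀ hd₁ hu hχ hdet hdeep₀ hdeep₁ hb₀ hb₁ hN₀ hN₁]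

end Assembly

end Literature.NumberTheory.Rogawski1990

end
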